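import Summits.MatrixMultiplication.MatrixMultiplication.Theorems.ObstructionDescentUniversalOccurrenceTwoRectangleTwoRowArith

set_option linter.dupNamespace false
set_option autoImplicit false

/-!
# Universal occurrence — two rectangles, THREE-ROW TYPES `(2N-2k-4, 2k+2, 2)`, part Q: arithmetic of the tall-pair design (decomp-mm · lens 3 · gen 43)

Route `route-MatrixMultiplication-ObstructionDescent` (sub-problem `MatrixMultiplication`, `ω(ℂ) = 2`); SUPPORT for the crux
`NoOccurrenceObstruction` (`P_O`, item `stmt-MatrixMultiplication-29040`) through the universal-occurrence programme (NODE-g29…g43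
of the decomp-mm cell, lens 3).  Nothing here proves `ω = 2` or closes an item; no `def`, no `sorry`, standard axioms.

**This file (elementary, shape-free).**  `sum_slots_tall_eq`: a slot function vanishing from slot `2k+3` on is the sum of its three
front values and its `k` pair values; `sum_tallColouring_eq` / `sum_tallIndicator_eq`: the colouring `g = (0,1,2, 0,1, 0,1, …)` has
`Σ g = k + 3` and takes the value `2` exactly once; `antiPairs_card_add_sum`: the parity law with a remainder term
(`#anti + Σ_j (A_j + A'_j) = k + 2 Σ_{anti} A_j`); `tallPair_local_configurations`: the LOCAL ALPHABET of the tall pair — columns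
`(A₀,B₀,A₁) ‖ (B₂,A₂,B₁)` injective with letters `< 3`, `B₁ = A₁` (twist), the letter `2` exactly once among `A₀,A₁,A₂` and among
`B₀,B₁,B₂` ⟹ twin (`B₂ = A₀`, `A₂ = B₀`) or anti-twin (`A₂ = A₀`, `B₂ = B₀`, and then `A₁ = 2`).

[cite: BurgisserIkenmeyer2011, §3.4 (Prop. 3.4), Thm. 4.4] [cite: BurgisserIkenmeyer2017, §5, Thm. 5.9 (proof of (2)), eq. (3.4)]
-/

noncomputable section

open scoped BigOperators

namespace Summit.MatrixMultiplication.MatrixMultiplication.Theorems.ObstructionCalculus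

/-! ### §1 Slot sums with a front block of three -/

/-- A slot function vanishing from slot `2k+3` on: three front values plus `k` pairs. [folklore] -/
theorem sum_slots_tall_eq {N k : ℕ} (hk : 2 * k + 3 ≤ N) (a : Fin N → ℕ)
    (h : ∀ s : Fin N, 2 * k + 3 ≤ (s : ℕ) → a s = 0) :
    ∑ s, a s = ((if h0 : 0 < N then a ⟨0, h0⟩ else 0) + (if h1 : 1 < N then a ⟨1, h1⟩ else 0) +
        (if h2 : 2 < N then a ⟨2, h2⟩ else 0)) +
      ∑ j ∈ Finset.range k, ((if hj : 2 * j + 3 < N then a ⟨2 * j + 3, hj⟩ else 0) +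
        (if hj : 2 * j + 4 < N then a ⟨2 * j + 4, hj⟩ else 0)) := by
  classical
  let a' : ℕ → ℕ := fun n => if hn : n < N then a ⟨n, hn⟩ else 0
  have ha' : ∀ s : Fin N, a s = a' s := fun s => by simp [a']
  have h1 : ∑ s : Fin N, a s = ∑ i ∈ Finset.range N, a' i := by
    rw [← Fin.sum_univ_eq_sum_range]
    exact Finset.sum_congr rfl (fun s _ => ha' s)
  have h2 : ∑ i ∈ Finset.range (3 + 2 * k), a' i = ∑ i ∈ Finset.range N, a' i := by
    apply Finset.sum_subset (fun x hx => Finset.mem_range.2 (lt_of_lt_of_le (Finset.mem_range.1 hx) (by omega)))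
    intro x hx hx2
    rw [Finset.mem_range] at hx hx2
    simp only [a', dif_pos hx]
    exact h _ (by simp; omega)
  rw [h1, ← h2, Finset.sum_range_add, sum_range_double]
  have h3 : ∑ x ∈ Finset.range 3, a' x = a' 0 + a' 1 + a' 2 := by
    simp [Finset.sum_range_succ]
  rw [h3]
  congr 1
  apply Finset.sum_congr rfl
  intro j hj
  rw [show 3 + 2 * j = 2 * j + 3 by ring, show 3 + (2 * j + 1) = 2 * j + 4 by ring]

/-- The tall colouring `g = (0,1,2,0,1,0,1,…)` (`k` pairs) has total `k + 3`. [folklore] -/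
theorem sum_tallColouring_eq {N k : ℕ} (hk : 2 * k + 3 ≤ N) (a : Fin N → ℕ)
    (ha : ∀ s : Fin N, a s = if (s : ℕ) < 3 then (s : ℕ)
      else if ((s : ℕ) < 2 * k + 3 ∧ (s : ℕ) % 2 = 0) then 1 else 0) : ∑ s, a s = k + 3 := by
  rw [sum_slots_tall_eq hk a (fun s hs => by rw [ha, if_neg (by omega), if_neg (by omega)])]
  have h : ∀ j ∈ Finset.range k, ((if hj : 2 * j + 3 < N then a ⟨2 * j + 3, hj⟩ else 0) +
      (if hj : 2 * j + 4 < N then a ⟨2 * j + 4, hj⟩ else 0)) = 1 := by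
    intro j hj
    rw [Finset.mem_range] at hj
    rw [dif_pos (by omega), dif_pos (by omega), ha, ha, if_neg (by dsimp only; omega),
      if_neg (by dsimp only; omega), if_neg (by dsimp only; omega), if_pos (by dsimp only; omega)]
  rw [Finset.sum_congr rfl h, dif_pos (by omega), dif_pos (by omega), dif_pos (by omega), ha, ha, ha]
  simp
  omega

set_option maxHeartbeats 400000 in
/-- The tall colouring takes the value `2` exactly once. [folklore] -/
theorem sum_tallIndicator_eq {N k : ℕ} (hk : 2 * k + 3 ≤ N) (g : Fin N → ℕ)
    (hg : ∀ s : Fin N, g s = if (s : ℕ) < 3 then (s : ℕ)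
      else if ((s : ℕ) < 2 * k + 3 ∧ (s : ℕ) % 2 = 0) then 1 else 0) :
    ∑ s, (if g s = 2 then 1 else 0) = 1 := by
  have hz : ∀ s : Fin N, 2 * k + 3 ≤ (s : ℕ) → (if g s = 2 then 1 else 0) = 0 := by
    intro s hs; rw [hg]; split_ifs <;> omega
  rw [sum_slots_tall_eq hk _ hz]
  have h : ∀ j ∈ Finset.range k,
      ((if hj : 2 * j + 3 < N then (if g ⟨2 * j + 3, hj⟩ = 2 then 1 else 0) else 0) +
      (if hj : 2 * j + 4 < N then (if g ⟨2 * j + 4, hj⟩ = 2 then 1 else 0) else 0)) = 0 := by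
    intro j hj
    rw [Finset.mem_range] at hj
    rw [dif_pos (by omega), dif_pos (by omega), hg, hg]
    split_ifs <;> simp_all
  rw [Finset.sum_congr rfl h, dif_pos (by omega), dif_pos (by omega), dif_pos (by omega), hg, hg, hg]
  simp

/-! ### §2 The parity law with remainder and the tall-pair alphabet -/

/-- **Parity law with remainder.**  For `k` pairs, each twin (`B'_j = A_j`, `A'_j + A_j = 1`) or anti-twin (`B'_j ≠ A_j`,
`A'_j = A_j`): `#anti + Σ_j (A_j + A'_j) = k + 2 Σ_{anti} A_j`. [folklore] -/
theorem antiPairs_card_add_sum (k : ℕ) (A A' B' : ℕ → ℕ)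
    (hcase : ∀ j < k, (B' j = A j ∧ A' j + A j = 1) ∨ (B' j ≠ A j ∧ A' j = A j)) :
    ((Finset.range k).filter (fun j => B' j ≠ A j)).card + ∑ j ∈ Finset.range k, (A j + A' j) =
      k + 2 * ∑ j ∈ (Finset.range k).filter (fun j => B' j ≠ A j), A j := by
  classical
  set U := (Finset.range k).filter (fun j => B' j ≠ A j) with hU
  set W := (Finset.range k).filter (fun j => ¬ B' j ≠ A j) with hW
  have hsplit := Finset.sum_filter_add_sum_filter_not (Finset.range k) (fun j => B' j ≠ A j) (fun j => A j + A' j)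
  have hUsum : ∑ j ∈ U, (A j + A' j) = 2 * ∑ j ∈ U, A j := by
    rw [Finset.mul_sum]
    apply Finset.sum_congr rfl
    intro j hj
    obtain ⟨hjk, hja⟩ := Finset.mem_filter.1 hj
    rw [Finset.mem_range] at hjk
    rcases hcase j hjk with ⟨h1, -⟩ | ⟨-, h2⟩
    · exact absurd h1 hja
    · rw [h2]; ring
  have hWsum : ∑ j ∈ W, (A j + A' j) = W.card := by
    rw [Finset.card_eq_sum_ones]
    apply Finset.sum_congr rfl
    intro j hj
    obtain ⟨hjk, hja⟩ := Finset.mem_filter.1 hj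
    rw [Finset.mem_range] at hjk
    rcases hcase j hjk with ⟨-, h1⟩ | ⟨h2, -⟩
    · omega
    · exact absurd h2 hja
  have hcard := Finset.card_filter_add_card_filter_not (s := Finset.range k) (fun j => B' j ≠ A j)
  rw [Finset.card_range] at hcard
  rw [← hU] at hsplit hcard
  rw [← hW] at hsplit hcard
  rw [hUsum, hWsum] at hsplit
  omega

/-- **Local alphabet of the tall pair.**  Columns `(A₀,B₀,A₁) ‖ (B₂,A₂,B₁)`, injective, letters `< 3`, `B₁ = A₁`, the letter `2`
exactly once among `A₀,A₁,A₂` and among `B₀,B₁,B₂`: twin (`B₂ = A₀ ∧ A₂ = B₀`) or anti-twin (`A₂ = A₀ ∧ B₂ = B₀`, forcing `A₁ = 2`).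
[folklore] -/
theorem tallPair_local_configurations (A0 B0 A1 B2 A2 B1 : ℕ)
    (hA0 : A0 < 3) (hB0 : B0 < 3) (hB2 : B2 < 3) (hA2 : A2 < 3) (hB1 : B1 < 3)
    (c01 : A0 ≠ B0) (c02 : A0 ≠ A1) (c12 : B0 ≠ A1) (c34 : B2 ≠ A2) (c35 : B2 ≠ B1) (c45 : A2 ≠ B1)
    (hH : B1 = A1)
    (oneA : (if A0 = 2 then 1 else 0) + (if A1 = 2 then 1 else 0) + (if A2 = 2 then 1 else 0) = 1)
    (oneB : (if B0 = 2 then 1 else 0) + (if B1 = 2 then 1 else 0) + (if B2 = 2 then 1 else 0) = 1) :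
    (B2 = A0 ∧ A2 = B0) ∨ (A2 = A0 ∧ B2 = B0 ∧ A1 = 2) := by
  by_cases h : A2 = A0
  · right
    refine ⟨h, ?_, ?_⟩ <;> split_ifs at oneA oneB <;> omega
  · left
    constructor <;> split_ifs at oneA oneB <;> omega

end Summit.MatrixMultiplication.MatrixMultiplication.Theorems.ObstructionCalculus
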